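import Mathlib.LinearAlgebra.Matrix.Rank
import Mathlib.Data.Complex.Basic
import Mathlib.Algebra.BigOperators.Fin
import Mathlib.Tactic.Ring
import Mathlib.Tactic.FinCases
import Literature.Computability.AlgebraicComplexity.MignonRessayreBound
import Summits.MatrixMultiplication.MatrixMultiplication.Theorems.ProbeRankScalingAggregationSaturationToolkit

/-!
# ProbeRankScaling / AggregationSaturation — Pan's two-fold aggregation at probe rank two

Helper for the support item `AggregationSaturation` (stmt-MatrixMultiplication-7540) of route
`ProbeRankScaling`: an explicit decomposition of `⟨2s,2s,2s⟩` over `ℂ` into `4(s³+3s²)` triads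
all of whose probes (three legs) have matrix rank `≤ 2` (`exists_decomp_pan`).

Construction (V. Pan's 1972 two-fold aggregation — "uniting" two disjoint matrix products —
Pan 1984, (4.1)–(4.3), applied to the four pairs `{(0,g,t),(1,g,t)}` of block products of a
`2 × 2`-blocked `⟨2s,2s,2s⟩`). For two disjoint trilinear matrix-product forms
`F₁ = ∑ z_{ki} x_{ij} y_{jk}` and `F₂ = ∑ w_{ij} u_{jk} v_{ki}` one has the polynomial identity
(`aggregation_identity`)

  `∑_{ijk} (z_{ki}+w_{ij})(x_{ij}+u_{jk})(y_{jk}+v_{ki}) − ∑_{ij} w_{ij} x_{ij} ∑_k (y_{jk}+v_{ki})`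
  `  − ∑_{ik} z_{ki} (∑_j (x_{ij}+u_{jk})) v_{ki} − ∑_{jk} (∑_i (z_{ki}+w_{ij})) u_{jk} y_{jk}`
  `  = F₁ + F₂`,

i.e. `s³` aggregated products plus `3s²` corrections compute both; the probes of the aggregated
terms are two-entry matrices, those of the corrections an entry, or a row-plus-column pattern —
all of rank `≤ 2`. Summing over the four block pairs gives `⟨2s,2s,2s⟩` with `4(s³+3s²)` terms.
Indicators are written `ite (· = ·) 1 0`, one factor per coordinate, so that every collapse of a
sum is `Fintype.sum_eq_single` / `Finset.sum_mul_boole`.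

References: V. Ya. Pan, *How to Multiply Matrices Faster*, LNCS 179, Springer 1984, §4,
(4.1)–(4.3); V. Ya. Pan, Strassen's algorithm is not optimal, FOCS 1978.
-/

-- `Summit.<Summit>.<Problem>` is the tree's mandated summit-side namespace; for this
-- single-conjunct summit the two coincide, so the file silences `dupNamespace`.
set_option linter.dupNamespace false

noncomputable section

open scoped BigOperators
open Function Matrix

namespace Summit.MatrixMultiplication.MatrixMultiplication.Theorems

namespace ProbeRankScalingAggregationSaturation

open Literature.Computability.AlgebraicComplexity

/-- **Pan's two-fold aggregation identity** (Pan 1984, (4.1)–(4.3)): for two disjoint matrix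
product forms `F₁ = ∑ z_{ki} x_{ij} y_{jk}`, `F₂ = ∑ w_{ij} u_{jk} v_{ki}`, the `s³` aggregates
`(z_{ki}+w_{ij})(x_{ij}+u_{jk})(y_{jk}+v_{ki})` together with `3s²` correction terms (whose
aggregated linear forms `X'`, `Y'`, `Z'` are row/column sums) compute `F₁ + F₂`; the corrections
are entered with the sign on the middle factor. [cite: Pan1984, (4.1)-(4.3)] -/
theorem aggregation_identity {R : Type*} [CommRing R] {β : Type*} [Fintype β]
    (x u y v z w X' Y' Z' : β → β → R)
    (hX : ∀ k i, X' k i = ∑ j, (x i j + u j k)) (hY : ∀ i j, Y' i j = ∑ k, (y j k + v k i))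
    (hZ : ∀ j k, Z' j k = ∑ i, (z k i + w i j)) :
    (∑ i, ∑ j, ∑ k, (z k i + w i j) * (x i j + u j k) * (y j k + v k i))
      + ((∑ i, ∑ j, w i j * (-x i j) * Y' i j)
      + ((∑ i, ∑ k, z k i * (-X' k i) * v k i)
      + (∑ j, ∑ k, Z' j k * (-u j k) * y j k)))
    = (∑ i, ∑ j, ∑ k, z k i * x i j * y j k) + ∑ i, ∑ j, ∑ k, w i j * u j k * v k i := by
  have e1 : (∑ i, ∑ j, w i j * (-x i j) * Y' i j)
      = ∑ i, ∑ j, ∑ k, w i j * (-x i j) * (y j k + v k i) := by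
    simp only [hY, Finset.mul_sum]
  have e2 : (∑ i, ∑ k, z k i * (-X' k i) * v k i)
      = ∑ i, ∑ j, ∑ k, z k i * (-(x i j + u j k)) * v k i := by
    refine Finset.sum_congr rfl fun i _ => ?_
    calc (∑ k, z k i * (-X' k i) * v k i)
        = ∑ k, ∑ j, z k i * (-(x i j + u j k)) * v k i := by
          refine Finset.sum_congr rfl fun k _ => ?_
          rw [hX, ← Finset.sum_neg_distrib, Finset.mul_sum, Finset.sum_mul]
      _ = ∑ j, ∑ k, z k i * (-(x i j + u j k)) * v k i := Finset.sum_comm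
  have e3 : (∑ j, ∑ k, Z' j k * (-u j k) * y j k)
      = ∑ i, ∑ j, ∑ k, (z k i + w i j) * (-u j k) * y j k := by
    calc (∑ j, ∑ k, Z' j k * (-u j k) * y j k)
        = ∑ j, ∑ k, ∑ i, (z k i + w i j) * (-u j k) * y j k := by
          refine Finset.sum_congr rfl fun j _ => Finset.sum_congr rfl fun k _ => ?_
          rw [hZ, Finset.sum_mul, Finset.sum_mul]
      _ = ∑ j, ∑ i, ∑ k, (z k i + w i j) * (-u j k) * y j k :=
          Finset.sum_congr rfl fun j _ => Finset.sum_comm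
      _ = ∑ i, ∑ j, ∑ k, (z k i + w i j) * (-u j k) * y j k := Finset.sum_comm
  rw [e1, e2, e3]
  simp only [← Finset.sum_add_distrib]
  refine Finset.sum_congr rfl fun i _ => Finset.sum_congr rfl fun j _ =>
    Finset.sum_congr rfl fun k _ => ?_
  ring

/-- Regrouping of the four families of terms of one block pair under the sums over the block
indices. [folklore] -/
theorem sum_regroup₄ (A B C D E : Fin 2 → Fin 2 → ℂ)
    (h : ∀ g t, A g t + (B g t + (C g t + D g t)) = E g t) :
    (∑ g, ∑ t, A g t) + ((∑ g, ∑ t, B g t) + ((∑ g, ∑ t, C g t) + ∑ g, ∑ t, D g t))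
      = ∑ g, ∑ t, E g t := by
  simp only [← h, Finset.sum_add_distrib]

/-- A function on `α × α` that is a sum of two products `φ₁(row) ψ₁(col) + φ₂(row) ψ₂(col)` is,
as a matrix, `φ₁ ψ₁ᵀ + φ₂ ψ₂ᵀ` and has rank `≤ 2`. [folklore] -/
theorem rank_le_two_of_eq {α : Type*} [Fintype α] (f : α × α → ℂ) (φ₁ ψ₁ φ₂ ψ₂ : α → ℂ)
    (h : ∀ q, f q = φ₁ q.1 * ψ₁ q.2 + φ₂ q.1 * ψ₂ q.2) : (Matrix.of (curry f)).rank ≤ 2 := by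
  have : Matrix.of (curry f) = vecMulVec φ₁ ψ₁ + vecMulVec φ₂ ψ₂ := by
    ext i j
    simp [vecMulVec_apply, curry, h]
  rw [this]
  exact rank_vecMulVec_add_vecMulVec_le _ _ _ _

variable {β : Type*} [Fintype β] [DecidableEq β]

/-- Collapse of the `F₁`-part (block products `(0,g,t)`) of the aggregated terms: summing the
products of the three one-entry indicators over all indices leaves the matrix multiplication
pattern on the block rows `0`. [folklore] -/
theorem sum_blockZero_collapse (a₁ a₃ b₁ b₃ c₁ c₃ : Fin 2) (a₂ a₄ b₂ b₄ c₂ c₄ : β) :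
    (∑ g : Fin 2, ∑ t : Fin 2, ∑ i : β, ∑ j : β, ∑ k : β,
      (ite (a₁ = 0) 1 0 * ite (a₃ = t) 1 0 * ite (a₄ = k) 1 0 * ite (a₂ = i) 1 0)
      * (ite (b₁ = 0) 1 0 * ite (b₂ = i) 1 0 * ite (b₃ = g) 1 0 * ite (b₄ = j) 1 0)
      * (ite (c₁ = g) 1 0 * ite (c₂ = j) 1 0 * ite (c₃ = t) 1 0 * ite (c₄ = k) 1 0) : ℂ)
    = ite (a₁ = 0) 1 0 * ite (b₁ = 0) 1 0 * (ite (a₂ = b₂) 1 0 * ite (b₃ = c₁) 1 0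
        * ite (b₄ = c₂) 1 0 * ite (a₃ = c₃) 1 0 * ite (a₄ = c₄) 1 0) := by
  rw [Fintype.sum_eq_single c₁ fun g hg => by simp [Ne.symm hg]]
  rw [Fintype.sum_eq_single c₃ fun t ht => by simp [Ne.symm ht]]
  rw [Fintype.sum_eq_single b₂ fun i hi => by simp [Ne.symm hi]]
  rw [Fintype.sum_eq_single c₂ fun j hj => by simp [Ne.symm hj]]
  rw [Fintype.sum_eq_single c₄ fun k hk => by simp [Ne.symm hk]]
  by_cases h₁ : a₂ = b₂ <;> by_cases h₂ : b₃ = c₁ <;> by_cases h₃ : b₄ = c₂ <;>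
    by_cases h₄ : a₃ = c₃ <;> by_cases h₅ : a₄ = c₄ <;> simp [h₁, h₂, h₃, h₄, h₅]

/-- Collapse of the `F₂`-part (block products `(1,g,t)`, entered with the rotated index roles
`w_{ij} u_{jk} v_{ki}` of the aggregation). [folklore] -/
theorem sum_blockOne_collapse (a₁ a₃ b₁ b₃ c₁ c₃ : Fin 2) (a₂ a₄ b₂ b₄ c₂ c₄ : β) :
    (∑ g : Fin 2, ∑ t : Fin 2, ∑ i : β, ∑ j : β, ∑ k : β,
      (ite (a₁ = 1) 1 0 * ite (a₂ = j) 1 0 * ite (a₃ = t) 1 0 * ite (a₄ = i) 1 0)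
      * (ite (b₁ = 1) 1 0 * ite (b₃ = g) 1 0 * ite (b₄ = k) 1 0 * ite (b₂ = j) 1 0)
      * (ite (c₁ = g) 1 0 * ite (c₃ = t) 1 0 * ite (c₄ = i) 1 0 * ite (c₂ = k) 1 0) : ℂ)
    = ite (a₁ = 1) 1 0 * ite (b₁ = 1) 1 0 * (ite (a₂ = b₂) 1 0 * ite (b₃ = c₁) 1 0
        * ite (b₄ = c₂) 1 0 * ite (a₃ = c₃) 1 0 * ite (a₄ = c₄) 1 0) := by
  rw [Fintype.sum_eq_single c₁ fun g hg => by simp [Ne.symm hg]]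
  rw [Fintype.sum_eq_single c₃ fun t ht => by simp [Ne.symm ht]]
  rw [Fintype.sum_eq_single c₄ fun i hi => by simp [Ne.symm hi]]
  rw [Fintype.sum_eq_single b₂ fun j hj => by simp [Ne.symm hj]]
  rw [Fintype.sum_eq_single c₂ fun k hk => by simp [Ne.symm hk]]
  by_cases h₁ : a₂ = b₂ <;> by_cases h₂ : b₃ = c₁ <;> by_cases h₃ : b₄ = c₂ <;>
    by_cases h₄ : a₃ = c₃ <;> by_cases h₅ : a₄ = c₄ <;> simp [h₁, h₂, h₃, h₄, h₅]

omit [Fintype β] in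
/-- The two block rows together give the matrix multiplication pattern. [folklore] -/
theorem blocks_combine (a₁ a₃ b₁ b₃ c₁ c₃ : Fin 2) (a₂ a₄ b₂ b₄ c₂ c₄ : β) :
    ite (a₁ = 0) 1 0 * ite (b₁ = 0) 1 0 * (ite (a₂ = b₂) 1 0 * ite (b₃ = c₁) 1 0
        * ite (b₄ = c₂) 1 0 * ite (a₃ = c₃) 1 0 * ite (a₄ = c₄) 1 0)
      + ite (a₁ = 1) 1 0 * ite (b₁ = 1) 1 0 * (ite (a₂ = b₂) 1 0 * ite (b₃ = c₁) 1 0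
        * ite (b₄ = c₂) 1 0 * ite (a₃ = c₃) 1 0 * ite (a₄ = c₄) 1 0)
    = (if ((a₁, a₂), (a₃, a₄)).1 = ((b₁, b₂), (b₃, b₄)).1 ∧
          ((b₁, b₂), (b₃, b₄)).2 = ((c₁, c₂), (c₃, c₄)).1 ∧
          ((a₁, a₂), (a₃, a₄)).2 = ((c₁, c₂), (c₃, c₄)).2 then (1 : ℂ) else 0) := by
  have hblk : (ite (a₁ = 0) 1 0 * ite (b₁ = 0) 1 0 + ite (a₁ = 1) 1 0 * ite (b₁ = 1) 1 0 : ℂ)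
      = ite (a₁ = b₁) 1 0 := by
    fin_cases a₁ <;> fin_cases b₁ <;> simp
  rw [← add_mul, hblk]
  simp only [Prod.mk.injEq]
  by_cases h₀ : a₁ = b₁ <;> by_cases h₁ : a₂ = b₂ <;> by_cases h₂ : b₃ = c₁ <;>
    by_cases h₃ : b₄ = c₂ <;> by_cases h₄ : a₃ = c₃ <;> by_cases h₅ : a₄ = c₄ <;>
    simp [h₀, h₁, h₂, h₃, h₄, h₅]

/-- **Pan's block-paired two-fold aggregation** for the abstract matrix multiplication tensor on
the index type `α = Fin 2 × β` (`2 × 2` blocks of size `|β|`): a decomposition into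
`4(|β|³ + 3|β|²)` triads — indexed by `(g,t,i,j,k)` (aggregates) and three families `(g,t,·,·)`
(corrections) — all of whose probes have rank `≤ 2`. [cite: Pan1984, (4.1)-(4.3)] -/
theorem exists_decomp_pan_abstract :
    ∃ (W U V : ((Fin 2 × Fin 2 × β × β × β) ⊕ (Fin 2 × Fin 2 × β × β) ⊕ (Fin 2 × Fin 2 × β × β)
        ⊕ (Fin 2 × Fin 2 × β × β)) → (Fin 2 × β) × (Fin 2 × β) → ℂ),
      (fun a b c : (Fin 2 × β) × (Fin 2 × β) =>
          if a.1 = b.1 ∧ b.2 = c.1 ∧ a.2 = c.2 then (1 : ℂ) else 0) =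
        ∑ s, triad (W s) (U s) (V s) ∧
      ∀ s, (Matrix.of (curry (W s))).rank ≤ 2 ∧ (Matrix.of (curry (U s))).rank ≤ 2 ∧
        (Matrix.of (curry (V s))).rank ≤ 2 := by
  refine ⟨
    -- W-probes (output slot `a`): aggregates `z_{ki} + w_{ij}`, then `w_{ij}`, `z_{ki}`, `Z'_{jk}`
    Sum.elim (fun ⟨_, t, i, j, k⟩ a =>
      ite (a.1.1 = 0) 1 0 * ite (a.2.1 = t) 1 0 * ite (a.2.2 = k) 1 0 * ite (a.1.2 = i) 1 0
      + ite (a.1.1 = 1) 1 0 * ite (a.1.2 = j) 1 0 * ite (a.2.1 = t) 1 0 * ite (a.2.2 = i) 1 0)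
    (Sum.elim (fun ⟨_, t, i, j⟩ a =>
      ite (a.1.1 = 1) 1 0 * ite (a.1.2 = j) 1 0 * ite (a.2.1 = t) 1 0 * ite (a.2.2 = i) 1 0)
    (Sum.elim (fun ⟨_, t, i, k⟩ a =>
      ite (a.1.1 = 0) 1 0 * ite (a.2.1 = t) 1 0 * ite (a.2.2 = k) 1 0 * ite (a.1.2 = i) 1 0)
    (fun ⟨_, t, j, k⟩ a =>
      ite (a.1.1 = 0) 1 0 * ite (a.2.1 = t) 1 0 * ite (a.2.2 = k) 1 0
      + ite (a.1.1 = 1) 1 0 * ite (a.1.2 = j) 1 0 * ite (a.2.1 = t) 1 0))),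
    -- U-probes (slot `b`, the `X`-matrix): `x_{ij} + u_{jk}`, then `-x_{ij}`, `-X'_{ki}`, `-u_{jk}`
    Sum.elim (fun ⟨g, _, i, j, k⟩ b =>
      ite (b.1.1 = 0) 1 0 * ite (b.1.2 = i) 1 0 * ite (b.2.1 = g) 1 0 * ite (b.2.2 = j) 1 0
      + ite (b.1.1 = 1) 1 0 * ite (b.2.1 = g) 1 0 * ite (b.2.2 = k) 1 0 * ite (b.1.2 = j) 1 0)
    (Sum.elim (fun ⟨g, _, i, j⟩ b =>
      -(ite (b.1.1 = 0) 1 0 * ite (b.1.2 = i) 1 0 * ite (b.2.1 = g) 1 0 * ite (b.2.2 = j) 1 0))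
    (Sum.elim (fun ⟨g, _, i, k⟩ b =>
      -(ite (b.1.1 = 0) 1 0 * ite (b.1.2 = i) 1 0 * ite (b.2.1 = g) 1 0
        + ite (b.1.1 = 1) 1 0 * ite (b.2.1 = g) 1 0 * ite (b.2.2 = k) 1 0))
    (fun ⟨g, _, j, k⟩ b =>
      -(ite (b.1.1 = 1) 1 0 * ite (b.2.1 = g) 1 0 * ite (b.2.2 = k) 1 0 * ite (b.1.2 = j) 1 0)))),
    -- V-probes (slot `c`, the `Y`-matrix): `y_{jk} + v_{ki}`, then `Y'_{ij}`, `v_{ki}`, `y_{jk}`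
    Sum.elim (fun ⟨g, t, i, j, k⟩ c =>
      ite (c.1.1 = g) 1 0 * ite (c.1.2 = j) 1 0 * ite (c.2.1 = t) 1 0 * ite (c.2.2 = k) 1 0
      + ite (c.1.1 = g) 1 0 * ite (c.2.1 = t) 1 0 * ite (c.2.2 = i) 1 0 * ite (c.1.2 = k) 1 0)
    (Sum.elim (fun ⟨g, t, i, j⟩ c =>
      ite (c.1.1 = g) 1 0 * ite (c.1.2 = j) 1 0 * ite (c.2.1 = t) 1 0
      + ite (c.1.1 = g) 1 0 * ite (c.2.1 = t) 1 0 * ite (c.2.2 = i) 1 0)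
    (Sum.elim (fun ⟨g, t, i, k⟩ c =>
      ite (c.1.1 = g) 1 0 * ite (c.2.1 = t) 1 0 * ite (c.2.2 = i) 1 0 * ite (c.1.2 = k) 1 0)
    (fun ⟨g, t, j, k⟩ c =>
      ite (c.1.1 = g) 1 0 * ite (c.1.2 = j) 1 0 * ite (c.2.1 = t) 1 0 * ite (c.2.2 = k) 1 0))),
    ?_, ?_⟩
  · -- the tensor identity, pointwise
    funext a b c
    obtain ⟨⟨a₁, a₂⟩, ⟨a₃, a₄⟩⟩ := a
    obtain ⟨⟨b₁, b₂⟩, ⟨b₃, b₄⟩⟩ := b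
    obtain ⟨⟨c₁, c₂⟩, ⟨c₃, c₄⟩⟩ := c
    rw [sum_triad_apply']
    simp only [Fintype.sum_sum_type, Fintype.sum_prod_type, Sum.elim_inl, Sum.elim_inr]
    have key : ∀ g t : Fin 2, _ := fun g t => aggregation_identity (R := ℂ)
      (x := fun i j => ite (b₁ = 0) 1 0 * ite (b₂ = i) 1 0 * ite (b₃ = g) 1 0 * ite (b₄ = j) 1 0)
      (u := fun j k => ite (b₁ = 1) 1 0 * ite (b₃ = g) 1 0 * ite (b₄ = k) 1 0 * ite (b₂ = j) 1 0)
      (y := fun j k => ite (c₁ = g) 1 0 * ite (c₂ = j) 1 0 * ite (c₃ = t) 1 0 * ite (c₄ = k) 1 0)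
      (v := fun k i => ite (c₁ = g) 1 0 * ite (c₃ = t) 1 0 * ite (c₄ = i) 1 0 * ite (c₂ = k) 1 0)
      (z := fun k i => ite (a₁ = 0) 1 0 * ite (a₃ = t) 1 0 * ite (a₄ = k) 1 0 * ite (a₂ = i) 1 0)
      (w := fun i j => ite (a₁ = 1) 1 0 * ite (a₂ = j) 1 0 * ite (a₃ = t) 1 0 * ite (a₄ = i) 1 0)
      (X' := fun k i => ite (b₁ = 0) 1 0 * ite (b₂ = i) 1 0 * ite (b₃ = g) 1 0
        + ite (b₁ = 1) 1 0 * ite (b₃ = g) 1 0 * ite (b₄ = k) 1 0)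
      (Y' := fun i j => ite (c₁ = g) 1 0 * ite (c₂ = j) 1 0 * ite (c₃ = t) 1 0
        + ite (c₁ = g) 1 0 * ite (c₃ = t) 1 0 * ite (c₄ = i) 1 0)
      (Z' := fun j k => ite (a₁ = 0) 1 0 * ite (a₃ = t) 1 0 * ite (a₄ = k) 1 0
        + ite (a₁ = 1) 1 0 * ite (a₂ = j) 1 0 * ite (a₃ = t) 1 0)
      (fun k i => by
        rw [Finset.sum_add_distrib, Finset.sum_mul_boole, Finset.sum_mul_boole]
        simp only [Finset.mem_univ, if_true])
      (fun i j => by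
        rw [Finset.sum_add_distrib, Finset.sum_mul_boole, Finset.sum_mul_boole]
        simp only [Finset.mem_univ, if_true])
      (fun j k => by
        rw [Finset.sum_add_distrib, Finset.sum_mul_boole, Finset.sum_mul_boole]
        simp only [Finset.mem_univ, if_true])
    rw [sum_regroup₄ _ _ _ _ _ key]
    simp only [Finset.sum_add_distrib]
    rw [sum_blockZero_collapse, sum_blockOne_collapse, blocks_combine]
  · -- probe ranks
    rintro (⟨g, t, i, j, k⟩ | ⟨g, t, i, j⟩ | ⟨g, t, i, k⟩ | ⟨g, t, j, k⟩) <;>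
      simp only [Sum.elim_inl, Sum.elim_inr] <;> refine ⟨?_, ?_, ?_⟩
    -- aggregates
    · exact rank_le_two_of_eq _ (fun r => ite (r.1 = 0) 1 0 * ite (r.2 = i) 1 0)
        (fun r => ite (r.1 = t) 1 0 * ite (r.2 = k) 1 0)
        (fun r => ite (r.1 = 1) 1 0 * ite (r.2 = j) 1 0)
        (fun r => ite (r.1 = t) 1 0 * ite (r.2 = i) 1 0) fun q => by ring
    · exact rank_le_two_of_eq _ (fun r => ite (r.1 = 0) 1 0 * ite (r.2 = i) 1 0)
        (fun r => ite (r.1 = g) 1 0 * ite (r.2 = j) 1 0)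
        (fun r => ite (r.1 = 1) 1 0 * ite (r.2 = j) 1 0)
        (fun r => ite (r.1 = g) 1 0 * ite (r.2 = k) 1 0) fun q => by ring
    · exact rank_le_two_of_eq _ (fun r => ite (r.1 = g) 1 0 * ite (r.2 = j) 1 0)
        (fun r => ite (r.1 = t) 1 0 * ite (r.2 = k) 1 0)
        (fun r => ite (r.1 = g) 1 0 * ite (r.2 = k) 1 0)
        (fun r => ite (r.1 = t) 1 0 * ite (r.2 = i) 1 0) fun q => by ring
    -- corrections C1
    · exact rank_le_two_of_eq _ (fun r => ite (r.1 = 1) 1 0 * ite (r.2 = j) 1 0)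
        (fun r => ite (r.1 = t) 1 0 * ite (r.2 = i) 1 0) 0 0 fun q => by
          simp only [Pi.zero_apply]; ring
    · exact rank_le_two_of_eq _ (fun r => -(ite (r.1 = 0) 1 0 * ite (r.2 = i) 1 0))
        (fun r => ite (r.1 = g) 1 0 * ite (r.2 = j) 1 0) 0 0 fun q => by
          simp only [Pi.zero_apply]; ring
    · exact rank_le_two_of_eq _ (fun r => ite (r.1 = g) 1 0 * ite (r.2 = j) 1 0)
        (fun r => ite (r.1 = t) 1 0) (fun r => ite (r.1 = g) 1 0)
        (fun r => ite (r.1 = t) 1 0 * ite (r.2 = i) 1 0) fun q => by ring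
    -- corrections C2
    · exact rank_le_two_of_eq _ (fun r => ite (r.1 = 0) 1 0 * ite (r.2 = i) 1 0)
        (fun r => ite (r.1 = t) 1 0 * ite (r.2 = k) 1 0) 0 0 fun q => by
          simp only [Pi.zero_apply]; ring
    · exact rank_le_two_of_eq _ (fun r => -(ite (r.1 = 0) 1 0 * ite (r.2 = i) 1 0))
        (fun r => ite (r.1 = g) 1 0) (fun r => -ite (r.1 = 1) 1 0)
        (fun r => ite (r.1 = g) 1 0 * ite (r.2 = k) 1 0) fun q => by ring
    · exact rank_le_two_of_eq _ (fun r => ite (r.1 = g) 1 0 * ite (r.2 = k) 1 0)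
        (fun r => ite (r.1 = t) 1 0 * ite (r.2 = i) 1 0) 0 0 fun q => by
          simp only [Pi.zero_apply]; ring
    -- corrections C3
    · exact rank_le_two_of_eq _ (fun r => ite (r.1 = 0) 1 0)
        (fun r => ite (r.1 = t) 1 0 * ite (r.2 = k) 1 0)
        (fun r => ite (r.1 = 1) 1 0 * ite (r.2 = j) 1 0)
        (fun r => ite (r.1 = t) 1 0) fun q => by ring
    · exact rank_le_two_of_eq _ (fun r => -(ite (r.1 = 1) 1 0 * ite (r.2 = j) 1 0))
        (fun r => ite (r.1 = g) 1 0 * ite (r.2 = k) 1 0) 0 0 fun q => by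
          simp only [Pi.zero_apply]; ring
    · exact rank_le_two_of_eq _ (fun r => ite (r.1 = g) 1 0 * ite (r.2 = j) 1 0)
        (fun r => ite (r.1 = t) 1 0 * ite (r.2 = k) 1 0) 0 0 fun q => by
          simp only [Pi.zero_apply]; ring

/-- **Pan's two-fold aggregation at probe rank two** (the statement of the sibling support item
`PanTwoFold`, proved here as a helper): for every `s`, an explicit decomposition of
`⟨2s,2s,2s⟩` over `ℂ` with `4(s³+3s²)` terms all of whose probes have matrix rank `≤ 2`.
[cite: Pan1984, (4.1)-(4.3)] -/
theorem exists_decomp_pan (s : ℕ) :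
    ∃ (w u v : Fin (4 * (s ^ 3 + 3 * s ^ 2)) → Fin (2 * s) × Fin (2 * s) → ℂ),
      matMulTensor ℂ (2 * s) (2 * s) (2 * s) = ∑ l, triad (w l) (u l) (v l) ∧
      ∀ l, (Matrix.of (curry (w l))).rank ≤ 2 ∧ (Matrix.of (curry (u l))).rank ≤ 2 ∧
        (Matrix.of (curry (v l))).rank ≤ 2 := by
  obtain ⟨W, U, V, hdec, hrank⟩ := exists_decomp_pan_abstract (β := Fin s)
  have hcard : Fintype.card ((Fin 2 × Fin 2 × Fin s × Fin s × Fin s)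
      ⊕ (Fin 2 × Fin 2 × Fin s × Fin s) ⊕ (Fin 2 × Fin 2 × Fin s × Fin s)
      ⊕ (Fin 2 × Fin 2 × Fin s × Fin s)) = 4 * (s ^ 3 + 3 * s ^ 2) := by
    simp only [Fintype.card_sum, Fintype.card_prod, Fintype.card_fin]
    ring
  exact exists_decomp_of_equiv finProdFinEquiv hcard W U V hdec hrank

end ProbeRankScalingAggregationSaturation

end Summit.MatrixMultiplication.MatrixMultiplication.Theorems

end
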